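import Summits.CriticalPhenomena.PercolationContinuityZ3.Theorems.PercNearOneGluingNoHeavyLowerTailSahiThreeCopyCellSlotDefs

/-!
# `NoHeavyLowerTail` (crux stmt-CriticalPhenomena-4575), Sahi programme: **CELL CERTIFICATES VII — CHAIN (BORDA) CELLS**: the Borda score family
# whose argmax cells are the ORDERINGS of four block scores, and the refinement of dominant-cell facts to finer families

Support file (Sahi cell, seat `prim-sahi-p1`, generation 65; `--supports stmt-CriticalPhenomena-4575`).  No evaluation; no `sorry`, standard axioms.

WHY (gen65 NOTES; kit j345549/j345562/j345568).  For `C₈ = (2,2,2,2)` at the all-`2` front profile the dominant cell `(1,1)` has NO certificate with flow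
generators + 2-face square rays (column generation stalls at phase-1 value `1/42` with vanishing reduced costs), whereas the six CHAIN sub-cells
`(1.2.3.4, 1.σ)` are feasible.  Chain cells need no new cell theorem: they are the argmax cells of the BORDA family `ℓ'_σ = 4ℓ_{σ0} + 3ℓ_{σ1} + 2ℓ_{σ2} +
ℓ_{σ3}` (rearrangement inequality), and a chain generator `ℓ_{σi} − ℓ_{σj}` (`i < j`) is `(ℓ'_σ − ℓ'_{σ∘(i j)})/(j − i)` — a kind-2 generator of
`…CellAccum` for the family `bordaScore4`.  WHAT: `perm4` (the 24 permutations, lexicographic), `bordaScore4`, the Boolean `domCheck` (each `ℓ_P − ℓ_j` is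
a positive submultiple of some `ℓ'_n − ℓ'_t`, checked on all codes), `dom_of_domCheck`, ★ `cellFacts_refine` (cell facts for a dominant cell `(P,Q)` give
cell facts for every finer cell `(n₁,n₂)` linked by `domCheck` — so dominant-cell certificates are reused, not duplicated, in a Borda-cell cover). [this work]
-/

namespace Summit.CriticalPhenomena.PercolationContinuityZ3.Theorems.SahiThreeCopy

open Finset Function Literature.Combinatorics.Sahi2008
open scoped BigOperators

variable {k : ℕ}

/-- The 24 permutations of `{0,1,2,3}` in lexicographic order (chain cells of four block scores). [this work] -/
def perm4 : List (List ℕ) :=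
  [[0,1,2,3], [0,1,3,2], [0,2,1,3], [0,2,3,1], [0,3,1,2], [0,3,2,1], [1,0,2,3], [1,0,3,2], [1,2,0,3], [1,2,3,0], [1,3,0,2], [1,3,2,0],
   [2,0,1,3], [2,0,3,1], [2,1,0,3], [2,1,3,0], [2,3,0,1], [2,3,1,0], [3,0,1,2], [3,0,2,1], [3,1,0,2], [3,1,2,0], [3,2,0,1], [3,2,1,0]]

/-- The BORDA SCORE FAMILY of four block scores: `ℓ'_n = 4ℓ_{σ0} + 3ℓ_{σ1} + 2ℓ_{σ2} + ℓ_{σ3}` for `σ = perm4[n]`; its argmax cells are the CHAIN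
cells (orderings of the block scores), and `ℓ_{σi} − ℓ_{σj} = (ℓ'_σ − ℓ'_{σ∘(i j)})/(j − i)`. [this work] -/
def bordaScore4 (ℓZ : ℕ → Pt k → ℤ) (n : ℕ) (e : Pt k) : ℤ :=
  4 * ℓZ ((perm4.getD n []).getD 0 0) e + 3 * ℓZ ((perm4.getD n []).getD 1 0) e + 2 * ℓZ ((perm4.getD n []).getD 2 0) e +
    ℓZ ((perm4.getD n []).getD 3 0) e

/-- DOMINANCE CHECK linking a dominant cell `P` (family `ℓZ`, `M` blocks) to a cell `n` of another family `ℓZ'` (`M'` members): for every `j < M`,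
`j ≠ P`, some `t < M'` and `c ∈ {1,2,3}` with `c·(ℓ_P − ℓ_j) = ℓ'_n − ℓ'_t` at all `2^k` codes. [this work] -/
def domCheck (k : ℕ) (ℓZ ℓZ' : ℕ → Pt k → ℤ) (M M' P n : ℕ) : Bool :=
  (List.range M).all fun j => j == P || (List.range M').any fun t => [1, 2, 3].any fun c =>
    (List.range (2 ^ k)).all fun x => (c : ℤ) * (ℓZ P (ptOfCode k x) - ℓZ j (ptOfCode k x)) == ℓZ' n (ptOfCode k x) - ℓZ' t (ptOfCode k x)

/-- A checked dominance link transfers the cell hypothesis: maximality of `ℓ'_n` implies dominance of `ℓ_P`. [this work] -/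
theorem dom_of_domCheck {ℓZ ℓZ' : ℕ → Pt k → ℤ} {M M' P n : ℕ} (h : domCheck k ℓZ ℓZ' M M' P n = true) {φ : Pt k → ℝ}
    (hmax : ∀ j, j < M' → ∑ e, (ℓZ' j e : ℝ) * φ e ≤ ∑ e, (ℓZ' n e : ℝ) * φ e) :
    ∀ j, j < M → ∑ e, (ℓZ j e : ℝ) * φ e ≤ ∑ e, (ℓZ P e : ℝ) * φ e := by
  intro j hj
  unfold domCheck at h
  simp only [List.all_eq_true, List.mem_range, Bool.or_eq_true, beq_iff_eq, List.any_eq_true, List.mem_cons, List.mem_nil_iff, or_false] at h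
  rcases h j hj with hjP | ⟨t, ht, c, hc, hall⟩
  · rw [hjP]
  · have hcpos : (0 : ℝ) < (c : ℝ) := by rcases hc with rfl | rfl | rfl <;> norm_num
    have key : ∀ e : Pt k, (c : ℝ) * ((ℓZ P e : ℝ) - (ℓZ j e : ℝ)) = (ℓZ' n e : ℝ) - (ℓZ' t e : ℝ) := by
      intro e
      have := hall (codeOf k e) (codeOf_lt k e)
      rw [ptOfCode_codeOf] at this
      exact_mod_cast this
    have hsum : (c : ℝ) * (∑ e, (ℓZ P e : ℝ) * φ e - ∑ e, (ℓZ j e : ℝ) * φ e) = ∑ e, (ℓZ' n e : ℝ) * φ e - ∑ e, (ℓZ' t e : ℝ) * φ e := by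
      rw [← sum_sub_distrib, ← sum_sub_distrib, mul_sum]
      refine sum_congr rfl fun e _ => ?_
      rw [← sub_mul, ← sub_mul, ← mul_assoc, key e]
    have ht' := hmax t ht
    nlinarith [hsum, ht', hcpos]

/-- ★ CELL FACTS FOR A FINER FAMILY FROM A DOMINANT-CELL CERTIFICATE: if `(P, Q)`-facts hold for the family `ℓ` and the dominance checks link
`P ↦ n₁`, `Q ↦ n₂` in the family `ℓ'`, then `(n₁, n₂)`-facts hold for `ℓ'` (same weight). [this work] -/
theorem cellFacts_refine {π : Fin k → ℕ} {f : Pt k → ℝ} {ℓZ ℓZ' : ℕ → Pt k → ℤ} {M M' P Q n₁ n₂ : ℕ} {θ : Pt k → Pt k → Pt k → ℝ}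
    (h₁ : domCheck k ℓZ ℓZ' M M' P n₁ = true) (h₂ : domCheck k ℓZ ℓZ' M M' Q n₂ = true)
    (h : CellFacts k π f M (fun j e => (ℓZ j e : ℝ)) P Q θ) : CellFacts k π f M' (fun j e => (ℓZ' j e : ℝ)) n₁ n₂ θ := by
  obtain ⟨hθ, hN1, hN2⟩ := h
  exact ⟨hθ, hN1, fun φ ψ hφ hψ hφm hψm hφc hψc =>
    hN2 φ ψ hφ hψ hφm hψm (dom_of_domCheck h₁ hφc) (dom_of_domCheck h₂ hψc)⟩

end Summit.CriticalPhenomena.PercolationContinuityZ3.Theorems.SahiThreeCopy
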